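import Summits.Parity.GeneralizedHardyLittlewood.Theorems.BeyondDiagonalBeatsQuarter.OffDiagCharacterBlock
import Summits.Parity.GeneralizedHardyLittlewood.Theorems.BeyondDiagonalBeatsQuarter.OffDiagPrincipalCoprime
import HarnessLib

/-!
# Route `PrimeLevelFamEdge`, crux K_B (stmt-Parity-20343), line `diagonal_kernel_split` rev 4, plan Ω, sub-line Ω-g (a8S) —
# **INDUCED characters: the Möbius–sublattice decomposition of a character-twisted complete `s`-sum**
# (the a8S twin of the sublattice structure of the principal part: tall moduli are NOT void)

`OffDiagCharacterBlock` (p650900) computed the twisted complete `s`-sum of a box transform for ANY twist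
`w : ℤ/n → ℂ`: `Σ_s w(s)·Φ̂(ξ₁, s/n + τ) = Σ_{j mod n} (𝓕w)(j)·e(−jτ)·𝓕(t₁ ↦ Φ(t₁, j))(ξ₁)` (one sample of the box weight per
residue), void when `𝓕w` misses the box, e.g. for a twist of period `d` when the box lies below height `n/d`. The a8S
twists are Dirichlet characters `χ mod n` of SMALL conductor; such a `χ` is induced (`χ = changeLevel _ ψ`, Mathlib) from a
character `ψ mod d`, `d ∣ n`, but — unless every prime of `n` divides `d` — it is NOT `d`-periodic on `ℤ/n` (it vanishes on
the non-units of `n`). This file makes the structure exact: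

* `ite_isUnit_char_inv_class_eq` — on the unit stratum the a8S twist `s ↦ χ(a(s)⁻¹)`, `a(s) = u·s⁻¹`, is `χ(u⁻¹)·χ(s)`;
* `inducedChar_intCast_eq_ite` — `χ(s) = ψ(s)` if `(s, n) = 1`, else `0`; with the Möbius inversion of the coprimality
  condition and the sublattice re-indexing of prover-5's `OffDiagPrincipalCoprime` (`tsum_ite_isCoprime_eq_sum_moebius`,
  the (U) twin): **`tsum_inducedChar_mul_eq_sum_divisors`** — for `F : ℤ → ℂ` absolutely summable,
  `Σ_s χ(s)·F(s) = Σ_{e ∣ n} μ(e)·ψ(e)·Σ_{s′} ψ(s′)·F(e·s′)` (only the square-free `e` coprime to `d` survive);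
* **`tsum_inducedChar_mul_fourier2_shift_eq`** — with `F(s) = Φ̂(ξ₁, s/n + τ)`: `F(e s′) = Φ̂(ξ₁, s′/(n/e) + τ)`, so the
  `χ`-block of modulus `n` is a signed sum over `e ∣ n` of `ψ`-twisted complete sums to the SMALLER moduli `n/e`, each
  of which is `OffDiagCharacterBlock.tsum_twist_mul_fourier2_shift_eq_samples` with the `d`-PERIODIC twist `ψ`
  (`factorTwist_periodic`): samples at the heights `≡ 0 (mod n/(e·d))` only (`dft_factorTwist_eq_zero`);
* **`tsum_inducedChar_mul_fourier2_shift_eq_zero`** — the exact VOID range: if the box lives on heights `(B₀, B)` with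
  `0 ≤ B₀` and `B·e·d ≤ n` for every `e ∣ n` with `μ(e)·ψ(e) ≠ 0`, the `χ`-block vanishes. In words: «void for
  `|h₁| ≥ B·d·r`», `r` = the largest square-free divisor of `|h₁|` coprime to `d` — NOT «`|h₁| ≥ B·d`»; tall moduli feed the
  box through their square-free `d`-coprime divisors, exactly as the principal part does through the Ramanujan sums
  `c_{n₀}(m)` (prover-5's (U) finding, adopted by the line lead 17:02Z).

Identities only (no bound — (S) is unfunded). Standard axioms; helper toward `stub_offDiagBelowSlack_io`; closes nothing.
«The programme SEARCHES and TYPES; no claim about Landau–Siegel zeros, Theorems 1–2 of arXiv:2211.02515 or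
a repaired Margin232 until a kernel theorem says so.»
-/

noncomputable section

open Real MeasureTheory Filter Complex Finset
open scoped FourierTransform Topology ContDiff ArithmeticFunction.Moebius ArithmeticFunction.zeta

namespace Summit.Parity.GeneralizedHardyLittlewood.Theorems.BeyondDiagonalBeatsQuarter.OffDiag

open Literature.NumberTheory.Sieve.FriedlanderIwaniecPrimes (fourier2)

/-! ### §1 Induced characters along `ℤ` and the Möbius inversion of the coprimality condition -/

section Induced

variable {n d : ℕ} [NeZero n]

omit [NeZero n] in
/-- **An induced character along `ℤ`**: for `ψ mod d`, `d ∣ n`, and `χ = changeLevel _ ψ` (the character mod `n` induced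
by `ψ`), `χ(s) = ψ(s)` if `(s, n) = 1` and `χ(s) = 0` otherwise. [folklore] -/
theorem inducedChar_intCast_eq_ite (hd : d ∣ n) (ψ : DirichletCharacter ℂ d) (s : ℤ) :
    DirichletCharacter.changeLevel hd ψ (s : ZMod n) =
      if IsCoprime s n then ψ (s : ZMod d) else 0 := by
  split_ifs with hs
  · exact DirichletCharacter.changeLevel_eq_cast_of_dvd' ψ hd hs
  · refine MulChar.map_nonunit _ fun hu ↦ hs ?_
    exact isCoprime_comm.mp ((ZMod.coe_int_isUnit_iff_isCoprime s n).mp hu)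

/-- **The a8S twist is a constant times `χ`.** For the classes of the block switch, `a(s) = u·s⁻¹` with a fixed unit `u`
(`u = −ab·c⁻¹` after absorbing `c` into `s`), the twist of the small-conductor part restricted to the non-empty (unit) stratum is
`𝟙[s unit]·χ(a(s)⁻¹) = χ(u⁻¹)·χ(s)` — so `OffDiagCharacterBlock` / this file apply with the twist `w = χ` itself. [folklore] -/
theorem ite_isUnit_char_inv_class_eq (χ : DirichletCharacter ℂ n) (u : (ZMod n)ˣ) (s : ZMod n) :
    (if IsUnit s then χ (((u : ZMod n) * s⁻¹)⁻¹) else 0) = χ ((u⁻¹ : (ZMod n)ˣ) : ZMod n) * χ s := by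
  by_cases hs : IsUnit s
  · obtain ⟨v, rfl⟩ := hs
    rw [if_pos (Units.isUnit v), ZMod.inv_coe_unit, ← Units.val_mul, ZMod.inv_coe_unit, mul_inv_rev, inv_inv,
      Units.val_mul, map_mul, mul_comm]
  · rw [if_neg hs, MulChar.map_nonunit χ hs, mul_zero]

end Induced

/-! ### §2 The Möbius–sublattice decomposition of a twisted series -/

section Sublattice

variable {n d : ℕ} [NeZero n]

/-- **Möbius–sublattice decomposition of an induced-character twist.** For `ψ mod d`, `d ∣ n`, `χ = changeLevel _ ψ`, and
`F : ℤ → ℂ` absolutely summable: `Σ_{s∈ℤ} χ(s)·F(s) = Σ_{e ∣ n} μ(e)·ψ(e)·Σ_{s′∈ℤ} ψ(s′)·F(e·s′)`. [folklore] -/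
theorem tsum_inducedChar_mul_eq_sum_divisors (hd : d ∣ n) (ψ : DirichletCharacter ℂ d) {F : ℤ → ℂ}
    (hF : Summable fun s : ℤ ↦ ‖F s‖) :
    ∑' s : ℤ, DirichletCharacter.changeLevel hd ψ (s : ZMod n) * F s =
      ∑ e ∈ n.divisors, (μ e : ℂ) * ψ (e : ZMod d) * ∑' s' : ℤ, ψ (s' : ZMod d) * F ((e : ℤ) * s') := by
  have hn : 0 < n := NeZero.pos n
  -- `χ(s)·F(s) = 𝟙[(s,n)=1]·(ψ(s)·F(s))`
  have hpt : ∀ s : ℤ, DirichletCharacter.changeLevel hd ψ (s : ZMod n) * F s =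
      if IsCoprime s (n : ℤ) then ψ (s : ZMod d) * F s else 0 := by
    intro s
    rw [inducedChar_intCast_eq_ite hd ψ s]
    split_ifs <;> simp
  simp_rw [hpt]
  -- the twisted family is summable (twist of norm ≤ 1 against `‖F‖`)
  have hsum : Summable fun s : ℤ ↦ ψ (s : ZMod d) * F s := by
    refine Summable.of_norm_bounded (g := fun s : ℤ ↦ 1 * ‖F s‖) (hF.mul_left 1) fun s ↦ ?_
    rw [norm_mul]
    exact mul_le_mul_of_nonneg_right (DirichletCharacter.norm_le_one ψ _) (norm_nonneg _)
  simp_rw [tsum_ite_isCoprime_eq_sum_moebius hn hsum]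
  refine Finset.sum_congr rfl fun e _ ↦ ?_
  have key : ∑' t : ℤ, ψ (((e : ℤ) * t : ℤ) : ZMod d) * F ((e : ℤ) * t) =
      ψ (e : ZMod d) * ∑' s' : ℤ, ψ (s' : ZMod d) * F ((e : ℤ) * s') := by
    rw [← tsum_mul_left]
    refine tsum_congr fun t ↦ ?_
    push_cast
    rw [map_mul]
    ring
  rw [mul_assoc, ← key]

end Sublattice

/-! ### §3 The factor twist on a smaller modulus: periodicity and lattice support of its DFT -/

section FactorTwist

variable {m d : ℕ} [NeZero m]

omit [NeZero m] in
/-- The twist `x ↦ ψ(x mod d)` on `ℤ/m` (`d ∣ m`) agrees with `s ↦ ψ(s mod d)` along `ℤ`. [folklore] -/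
theorem factorTwist_intCast (hd : d ∣ m) (ψ : DirichletCharacter ℂ d) (s : ℤ) :
    ψ (ZMod.castHom hd (ZMod d) ((s : ℤ) : ZMod m)) = ψ (s : ZMod d) := by
  rw [map_intCast]

omit [NeZero m] in
/-- The twist `x ↦ ψ(x mod d)` on `ℤ/m` is `d`-PERIODIC. [folklore] -/
theorem factorTwist_periodic (hd : d ∣ m) (ψ : DirichletCharacter ℂ d) (x : ZMod m) :
    ψ (ZMod.castHom hd (ZMod d) (x + d)) = ψ (ZMod.castHom hd (ZMod d) x) := by
  rw [map_add, map_natCast, ZMod.natCast_self, add_zero]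

/-- Hence its DFT lives on the lattice `{j : d·j = 0}` of spacing `m/d` (`OffDiagCharacterBlock.dft_eq_zero_of_periodic`).
[folklore] -/
theorem dft_factorTwist_eq_zero (hd : d ∣ m) (ψ : DirichletCharacter ℂ d) {j : ZMod m} (hj : (d : ZMod m) * j ≠ 0) :
    ZMod.dft (fun x : ZMod m ↦ ψ (ZMod.castHom hd (ZMod d) x)) j = 0 :=
  dft_eq_zero_of_periodic (fun x ↦ factorTwist_periodic hd ψ x) hj

/-- **Heights below the lattice spacing are off the lattice**: for `d ≥ 1` and `j ∈ ℤ/m` with `0 < j.val` and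
`j.val·d < m`, `d·j ≠ 0` in `ℤ/m`. [folklore] -/
theorem natCast_mul_ne_zero_of_val_lt (hd0 : 0 < d) {j : ZMod m} (hj0 : 0 < j.val) (hjm : j.val * d < m) :
    (d : ZMod m) * j ≠ 0 := by
  intro h
  have hval : ((d * j.val : ℕ) : ZMod m) = 0 := by
    push_cast
    rw [ZMod.natCast_zmod_val]
    exact h
  rw [ZMod.natCast_eq_zero_iff] at hval
  have hle := Nat.le_of_dvd (Nat.mul_pos hd0 hj0) hval
  rw [mul_comm] at hle
  omega

/-- **The factor twist block**: for `d ∣ m`, `ψ mod d`, a box below height `m`: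
`Σ_{s∈ℤ} ψ(s)·Φ̂(ξ₁, s/m + τ) = Σ_{j mod m} (𝓕w)(j)·e(−jτ)·𝓕(t₁ ↦ Φ(t₁, j))(ξ₁)`, `w = ψ ∘ (mod d)` — and `(𝓕w)(j) = 0`
unless `d·j = 0`. [folklore] -/
theorem tsum_factorTwist_mul_fourier2_shift_eq_samples {Φ : ℝ → ℝ → ℂ} (hΦ : ContDiff ℝ ∞ (Function.uncurry Φ))
    (hΦc : HasCompactSupport (Function.uncurry Φ)) (hsupp : ∀ t₁ t₂, Φ t₁ t₂ ≠ 0 → 0 < t₂ ∧ t₂ < m)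
    (hd : d ∣ m) (ψ : DirichletCharacter ℂ d) (τ ξ₁ : ℝ) :
    ∑' s : ℤ, ψ (s : ZMod d) * fourier2 Φ ξ₁ ((s : ℝ) / m + τ) =
      ∑ j : ZMod m, ZMod.dft (fun x : ZMod m ↦ ψ (ZMod.castHom hd (ZMod d) x)) j *
        ((𝐞 (-((j.val : ℝ) * τ)) : ℂ) * 𝓕 (fun t₁ : ℝ ↦ Φ t₁ j.val) ξ₁) := by
  rw [← tsum_twist_mul_fourier2_shift_eq_samples hΦ hΦc hsupp _ τ ξ₁]
  exact tsum_congr fun s ↦ by rw [factorTwist_intCast hd ψ s]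

/-- **VOID for the factor twist**: if the box lives on heights `(B₀, B)` with `0 ≤ B₀` and `B·d ≤ m`, then
`Σ_{s∈ℤ} ψ(s)·Φ̂(ξ₁, s/m + τ) = 0` (every height `j` in the box has `0 < j < m/d`, hence `d·j ≠ 0`). [folklore] -/
theorem tsum_factorTwist_eq_zero_of_height {Φ : ℝ → ℝ → ℂ} (hΦ : ContDiff ℝ ∞ (Function.uncurry Φ))
    (hΦc : HasCompactSupport (Function.uncurry Φ)) {B₀ B : ℝ} (hB₀ : 0 ≤ B₀)
    (hsupp : ∀ t₁ t₂, Φ t₁ t₂ ≠ 0 → B₀ < t₂ ∧ t₂ < B) (hd : d ∣ m) (hB : B * d ≤ m)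
    (ψ : DirichletCharacter ℂ d) (τ ξ₁ : ℝ) :
    ∑' s : ℤ, ψ (s : ZMod d) * fourier2 Φ ξ₁ ((s : ℝ) / m + τ) = 0 := by
  have hd0 : 0 < d := Nat.pos_of_ne_zero fun h ↦ by
    subst h; exact NeZero.ne m (Nat.eq_zero_of_zero_dvd hd)
  have hBm : B ≤ m := by
    rcases le_or_gt 0 B with hB0 | hB0
    · exact (le_mul_of_one_le_right hB0 (by exact_mod_cast hd0)).trans hB
    · exact hB0.le.trans (Nat.cast_nonneg _)
  have h := tsum_twist_eq_zero_of_periodic hΦ hΦc hB₀ hBm hsupp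
    (w := fun x : ZMod m ↦ ψ (ZMod.castHom hd (ZMod d) x)) (d := (d : ZMod m))
    (fun x ↦ factorTwist_periodic hd ψ x) (fun j hj1 hj2 ↦ ?_) τ ξ₁
  · rw [← h]
    exact tsum_congr fun s ↦ by rw [factorTwist_intCast hd ψ s]
  · have hj0 : 0 < j.val := by exact_mod_cast lt_of_le_of_lt hB₀ hj1
    have hjm : j.val * d < m := by
      have : (j.val : ℝ) * d < B * d := mul_lt_mul_of_pos_right hj2 (by exact_mod_cast hd0)
      exact_mod_cast this.trans_le hB
    exact natCast_mul_ne_zero_of_val_lt hd0 hj0 hjm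

end FactorTwist

/-! ### §4 The induced-character block of one dual modulus -/

section InducedBlock

variable {n d : ℕ} [NeZero n] {Φ : ℝ → ℝ → ℂ}

/-- **The `χ`-block of modulus `n` as a Möbius sum of `ψ`-blocks of the moduli `n/e`.** For `ψ mod d`, `d ∣ n`,
`χ = changeLevel _ ψ`, `uncurry Φ` smooth of compact support, `τ, ξ₁ ∈ ℝ`:
`Σ_{s∈ℤ} χ(s)·Φ̂(ξ₁, s/n + τ) = Σ_{e ∣ n} μ(e)·ψ(e)·Σ_{s′∈ℤ} ψ(s′)·Φ̂(ξ₁, s′/(n/e) + τ)`. [folklore] -/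
theorem tsum_inducedChar_mul_fourier2_shift_eq (hΦ : ContDiff ℝ ∞ (Function.uncurry Φ))
    (hΦc : HasCompactSupport (Function.uncurry Φ)) (hd : d ∣ n) (ψ : DirichletCharacter ℂ d) (τ ξ₁ : ℝ) :
    ∑' s : ℤ, DirichletCharacter.changeLevel hd ψ (s : ZMod n) * fourier2 Φ ξ₁ ((s : ℝ) / n + τ) =
      ∑ e ∈ n.divisors, (μ e : ℂ) * ψ (e : ZMod d) *
        ∑' s' : ℤ, ψ (s' : ZMod d) * fourier2 Φ ξ₁ ((s' : ℝ) / ((n / e : ℕ) : ℝ) + τ) := by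
  have hn : ((n : ℕ) : ℤ) ≠ 0 := by exact_mod_cast NeZero.ne n
  have hF : Summable fun s : ℤ ↦ ‖fourier2 Φ ξ₁ ((s : ℝ) / n + τ)‖ :=
    summable_norm_iff.mpr (summable_fourier2_intShift hΦ hΦc hn τ ξ₁)
  have h := tsum_inducedChar_mul_eq_sum_divisors hd ψ hF
  push_cast at h
  rw [h]
  refine Finset.sum_congr rfl fun e he ↦ ?_
  congr 1
  refine tsum_congr fun s' ↦ ?_
  congr 2
  -- `(e·s′)/n = s′/(n/e)` for `e ∣ n`
  have hed : e ∣ n := Nat.dvd_of_mem_divisors he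
  have he0 : (e : ℝ) ≠ 0 := by exact_mod_cast Nat.pos_iff_ne_zero.mp (Nat.pos_of_mem_divisors he)
  have hne : ((n / e : ℕ) : ℝ) * e = n := by exact_mod_cast Nat.div_mul_cancel hed
  rw [← hne]
  field_simp

/-- **The exact VOID range of the induced-character block.** If the box lives on heights `(B₀, B)` (`0 ≤ B₀`) and
`B·e·d ≤ n` for every divisor `e ∣ n` with `μ(e)·ψ(e) ≠ 0` (equivalently: for the largest square-free divisor of `n`
coprime to `d`), then `Σ_{s∈ℤ} χ(s)·Φ̂(ξ₁, s/n + τ) = 0`. [folklore] -/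
theorem tsum_inducedChar_mul_fourier2_shift_eq_zero (hΦ : ContDiff ℝ ∞ (Function.uncurry Φ))
    (hΦc : HasCompactSupport (Function.uncurry Φ)) {B₀ B : ℝ} (hB₀ : 0 ≤ B₀)
    (hsupp : ∀ t₁ t₂, Φ t₁ t₂ ≠ 0 → B₀ < t₂ ∧ t₂ < B) (hd : d ∣ n) (ψ : DirichletCharacter ℂ d)
    (hvoid : ∀ e ∈ n.divisors, (μ e : ℂ) * ψ (e : ZMod d) ≠ 0 → B * (e * d) ≤ n) (τ ξ₁ : ℝ) :
    ∑' s : ℤ, DirichletCharacter.changeLevel hd ψ (s : ZMod n) * fourier2 Φ ξ₁ ((s : ℝ) / n + τ) = 0 := by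
  rw [tsum_inducedChar_mul_fourier2_shift_eq hΦ hΦc hd ψ τ ξ₁]
  refine Finset.sum_eq_zero fun e he ↦ ?_
  by_cases hz : (μ e : ℂ) * ψ (e : ZMod d) = 0
  · rw [hz, zero_mul]
  · have he' : e ∣ n := Nat.dvd_of_mem_divisors he
    have he0 : 0 < e := Nat.pos_of_mem_divisors he
    haveI : NeZero (n / e) := ⟨(Nat.div_pos (Nat.le_of_dvd (NeZero.pos n) he') he0).ne'⟩
    -- `d ∣ n/e`: `e` is coprime to `d` since `ψ(e) ≠ 0`
    have hcop : Nat.Coprime e d := by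
      have hu : IsUnit ((e : ℕ) : ZMod d) := by
        by_contra hnu
        exact hz (by rw [MulChar.map_nonunit _ hnu, mul_zero])
      exact (ZMod.isUnit_iff_coprime e d).mp hu
    have hdne : d ∣ n / e := by
      have : e * d ∣ n := Nat.Coprime.mul_dvd_of_dvd_of_dvd hcop he' hd
      exact Nat.dvd_div_of_mul_dvd this
    have hB : B * d ≤ ((n / e : ℕ) : ℝ) := by
      have h1 := hvoid e he hz
      have he0r : (0 : ℝ) < e := by exact_mod_cast he0
      have hne : ((n / e : ℕ) : ℝ) = (n : ℝ) / e := by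
        rw [Nat.cast_div he' (by exact_mod_cast he0.ne')]
      rw [hne, le_div_iff₀ he0r]
      calc B * d * e = B * (e * d) := by ring
        _ ≤ n := h1
    rw [tsum_factorTwist_eq_zero_of_height hΦ hΦc hB₀ hsupp hdne hB ψ τ ξ₁, mul_zero]

end InducedBlock

end Summit.Parity.GeneralizedHardyLittlewood.Theorems.BeyondDiagonalBeatsQuarter.OffDiag
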